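import Summits.HodgeConjecture.HodgeConjecture.Theorems.Ring2HypothesesDescentLefschetzBRungsNested
import Summits.HodgeConjecture.HodgeConjecture.Theses.MotivatedLefschetzSplit
import HarnessLib

/-!
# Crux `LefschetzStandardB` (stmt-HodgeConjecture-17489) — its FIRST SUSPECT CLASS as rungs: `LefschetzStandardB` gives
# every rung `(5∀)_d` of ring 2's node X = `LefschetzBCompactPencils` (conjecture `B` for the total spaces of compact pencils
# of abelian `d`-folds), hence X, hence — through André 1996 §6.3 as certified by ring 2 — `HC_AV`; all FACT-FREE but the last.

Route `HodgeConjecture/MotivatedLefschetzSplit`, crux #3 `LefschetzStandardB := ∀ d Z η, IsSmoothProjective d Z →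
StandardConjectureBStar d Z η`, whose recorded why-might-fail names «very general Weil-type abelian-pencil total spaces» as the
first suspect class, and whose registered line `Cruxes/LefschetzStandardB/Lines/birth.lean` has one open stub, `stub_familySupply`
(Charles 2013 Prop. 8, open from `d = 3, b = 2`). Ring 2 graded that suspect class by the fibre dimension: `(5∀)_d =
Ring2.AbelianAll.LefschetzBCompactPencilsAtRelDim d` (`B⋆` for the `(d+1)`-fold total space of every compact pencil of abelian
`d`-folds), with `(5∀)_d` a theorem for `d ≤ 2` modulo Tankeev 2011 and the rungs NESTED DOWNWARD
(`lefschetzBCompactPencilsAtRelDim_anti`, `lefschetzBCompactPencils_iff_forall_le`). This file records, for the crux's dossier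
(director-hodge ruling 2026-08-25T20:22:58Z, D-0059 road b05: «home = stmt-HodgeConjecture-17489, no new route»):

* `lefschetzBCompactPencilsAtRelDim_of_lefschetzStandardB : LefschetzStandardB → ∀ d, (5∀)_d` — the total space is a smooth
  projective `(d+1)`-fold (`IsCompactAbelianPencil.isSmoothProjective_total`); one term;
* `lefschetzBCompactPencils_of_lefschetzStandardB : LefschetzStandardB → X`;
* `HC_AV_of_andre1996_of_lefschetzStandardB : [h₂₁] → [h₂₂] → LefschetzStandardB → HodgeAbelianVarieties` — André's
  «`B(X)` for abelian-pencil total spaces ⟹ the Hodge conjecture for abelian varieties» through ring 2's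
  `HC_AV_of_andre1996_of_lefschetzBCompactPencils` (André 1996 §6.3 print binders `h₂₁ h₂₂` displayed, no `HC_CM`);
* `tail_of_lefschetzStandardB` / `lowRungs_of_tail` — the first open rung is `d = 3` (fourfolds fibred in abelian threefolds) and
  any tail `∀ d ≥ d₀, (5∀)_d` already gives every lower rung (so a rung is a FRONTIER target of the crux, never a co-hypothesis
  beside its own tail).

What this is NOT: not a case of `B` or of the Hodge conjecture; no rung is proved here; no definition, no named fact, no sorry.
References: [Grothendieck1968] §3 (p. 196, `B(X)`); [Andre1996Motifs] §6.3, Lemme 6.3.1–6.3.3 and Remarque 2 (pp. 31–33);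
[Charles2013] Prop. 8; [Milne2020HodgeClassesAV] Thm. 4.
-/

noncomputable section

open CategoryTheory CategoryTheory.Limits AlgebraicGeometry MonoidalCategory CartesianMonoidalCategory
open Literature.AlgebraicGeometry Literature.AlgebraicGeometry.Motives Literature.AlgebraicGeometry.HodgeTheory
open Literature.AlgebraicGeometry.Andre1996 (andre1996_cmAnchoredPencil andre1996_cmHodgeClasses_algebraicallyAnchoredPencils)
open Summit.HodgeConjecture.HodgeConjecture.Theses
open Summit.HodgeConjecture.HodgeConjecture.Ring2.AbelianAll
open Summit.HodgeConjecture.HodgeConjecture.Theorems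

namespace Summit.HodgeConjecture.HodgeConjecture.Theorems.LefschetzStandardB

/-- **`LefschetzStandardB ⟹ (5∀)_d` for every `d`**: the total space of a compact pencil of abelian `d`-folds is a smooth projective
`(d+1)`-fold, so Grothendieck's `B` in André's `⋆_L`-form for all smooth projective varieties contains every rung of ring 2's node X.
[cite: Grothendieck1968, §3 p. 196 (B(X))] -/
theorem lefschetzBCompactPencilsAtRelDim_of_lefschetzStandardB (hB : MotivatedLefschetzSplit.LefschetzStandardB) (d : ℕ) :
    LefschetzBCompactPencilsAtRelDim d :=
  fun 𝒳 _S _f hf ηX ↦ hB (d + 1) 𝒳 ηX hf.isSmoothProjective_total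

/-- **`LefschetzStandardB ⟹ X`** (`X = LefschetzBCompactPencils`, all relative dimensions at once). [cite: Grothendieck1968, §3 p. 196 (B(X))] -/
theorem lefschetzBCompactPencils_of_lefschetzStandardB (hB : MotivatedLefschetzSplit.LefschetzStandardB) : LefschetzBCompactPencils :=
  lefschetzBCompactPencils_iff_forall_atRelDim.2 (lefschetzBCompactPencilsAtRelDim_of_lefschetzStandardB hB)

/-- **`LefschetzStandardB ⟹ HC_AV` modulo André 1996 §6.3 (`h₂₁ h₂₂` displayed), with NO `HC_CM`**: André's theorem «conjecture
`B` for the total spaces of compact abelian pencils implies the Hodge conjecture for all complex abelian varieties», through ring 2's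
certified road `HC_AV_of_andre1996_of_lefschetzBCompactPencils`. For the record of route MotivatedLefschetzSplit: its crux `B`
alone reaches the abelian-varieties conjunct. [cite: Andre1996Motifs, Lemme 6.3.1–6.3.3 and Remarque 2 (pp. 31–33)]
[cite: Milne2020HodgeClassesAV, Thm. 4 (p. 8)] -/
theorem HC_AV_of_andre1996_of_lefschetzStandardB (h₂₁ : andre1996_cmAnchoredPencil)
    (h₂₂ : andre1996_cmHodgeClasses_algebraicallyAnchoredPencils) (hB : MotivatedLefschetzSplit.LefschetzStandardB) :
    PadicSemiregularLift.HodgeAbelianVarieties :=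
  HC_AV_of_andre1996_of_lefschetzBCompactPencils h₂₁ h₂₂ (lefschetzBCompactPencils_of_lefschetzStandardB hB)

/-- **Every tail of the ladder is the whole ladder**: `(∀ d ≥ d₀, (5∀)_d) ⟹ (5∀)_d` for EVERY `d` (nesting, fact-free). Consequence
for filing: a rung `(5∀)_d` is a frontier target of the crux; placed beside its own tail in a `closes` it is never load-bearing.
[cite: Andre1996Motifs, §6.3 Remarque 2 (p. 33)] -/
theorem lowRungs_of_tail (d₀ : ℕ) (h : ∀ d : ℕ, d₀ ≤ d → LefschetzBCompactPencilsAtRelDim d) (d : ℕ) :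
    LefschetzBCompactPencilsAtRelDim d :=
  lefschetzBCompactPencils_iff_forall_atRelDim.1 ((lefschetzBCompactPencils_iff_forall_le d₀).2 h) d

/-- `LefschetzStandardB` gives every tail (trivially, via every rung) — recorded so that the crux's dossier carries both directions
of the bookkeeping `LefschetzStandardB ⟹ tail ⟹ all rungs`. [cite: Grothendieck1968, §3 p. 196 (B(X))] -/
theorem tail_of_lefschetzStandardB (hB : MotivatedLefschetzSplit.LefschetzStandardB) (d₀ : ℕ) :
    ∀ d : ℕ, d₀ ≤ d → LefschetzBCompactPencilsAtRelDim d :=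
  fun d _ ↦ lefschetzBCompactPencilsAtRelDim_of_lefschetzStandardB hB d

/-- **The first open rung, as an instance of the crux**: `B⋆` for the FOURFOLD total space of every compact pencil of abelian
THREEFOLDS, for every polarisation class — the smallest member of the crux's first suspect class (rungs `d ≤ 2` are Tankeev 2011).
[cite: Grothendieck1968, §3 p. 196 (B(X))] [cite: Charles2013, Prop. 8] -/
theorem standardConjectureBStar_abelianThreefoldPencil_of_lefschetzStandardB (hB : MotivatedLefschetzSplit.LefschetzStandardB)
    {𝒳 S : SchemeOver ℂ} (f : 𝒳 ⟶ S) (hf : IsCompactAbelianPencil f 3) (ηX : complexBetti 𝒳 2) :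
    StandardConjectureBStar (3 + 1) 𝒳 ηX :=
  lefschetzBCompactPencilsAtRelDim_of_lefschetzStandardB hB 3 f hf ηX

section Locators
#check @MotivatedLefschetzSplit.LefschetzStandardB
#check @lefschetzBCompactPencilsAtRelDim_anti
#check @lefschetzBCompactPencils_iff_forall_le
#check @lefschetzBCompactPencils_iff_forall_atRelDim
#check @HC_AV_of_andre1996_of_lefschetzBCompactPencils
#check @IsCompactAbelianPencil.isSmoothProjective_total
end Locators

#print axioms lefschetzBCompactPencilsAtRelDim_of_lefschetzStandardB
#print axioms HC_AV_of_andre1996_of_lefschetzStandardB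

end Summit.HodgeConjecture.HodgeConjecture.Theorems.LefschetzStandardB

end
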